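import Mathlib.Analysis.Calculus.SmoothSeries
import Mathlib.Analysis.Calculus.Deriv.Pow
import Mathlib.Analysis.SpecificLimits.Normed
import Mathlib.Analysis.Analytic.OfScalars
import Mathlib.Analysis.Calculus.FDeriv.Analytic
import Mathlib.Analysis.Normed.Group.FunctionSeries
import HarnessLib

/-!
# The Frobenius series of the axisymmetric spheroidal equation at a pole

Topic `Literature/Analysis/SpecialFunctions` (namespace `Literature.Analysis.SpecialFunctions`).
The angular equation of a separated axisymmetric solution `e^{-iωt} S(cos θ) R(r)` of the
Klein–Gordon equation `□_g ψ = μ² ψ` on a Kerr background is the (prolate) spheroidal equation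
with azimuthal number `m = 0`,
  `d/dχ ((1 - χ²) dS/dχ) + (λ - c χ²) S = 0`,   `χ = cos θ ∈ [-1, 1]`,  `c = a²(μ² - ω²)`
(Shlapentokh-Rothman, Comm. Math. Phys. 329 (2014), §2, the angular ODE with `m = 0`;
Flammer, *Spheroidal wave functions* (1957), Ch. 2; NIST DLMF §30.2). Both poles `χ = ±1` are
regular singular points with double indicial exponent `0`; in the variable `s = 1 - χ` the
equation reads `s(2 - s) S'' + (2 - 2s) S' + (λ - c(1 - s)²) S = 0` and its solution analytic at
the pole `s = 0`, normalised by `S = 1` there, is the power series `Σ bₙ sⁿ` with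
  `b₀ = 1`,  `2(n+1)² b_{n+1} = (n(n+1) - λ + c) bₙ - 2c b_{n-1} + c b_{n-2}`.
This file constructs that series and proves, from Mathlib only:

* `sphCoeff λ c n` — the coefficients (`sphTriple` carries three consecutive ones), the
  recursion (`sphCoeff_succ_succ_succ`) and the bound `|bₙ| ≤ (11/20)ⁿ` for `|λ| ≤ 1/2`,
  `0 ≤ c ≤ 1/100` (`abs_sphCoeff_le`), whence radius of convergence `≥ 20/11 > 1`;
* generic one-variable power-series calculus under a geometric coefficient bound `|bₙ| ≤ pⁿ`:
  `psFun b`, `psDer b`, `psDer₂ b` (the series and its two term-wise derivatives),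
  `hasDerivAt_psFun`, `hasDerivAt_psDer` on `|s| < p⁻¹` (`hasDerivAt_tsum_of_isPreconnected`),
  and `contDiffAt_psFun` (the sum is analytic inside the radius, via
  `FormalMultilinearSeries.ofScalars`);
* `sphFun_ode` — the series solves the spheroidal equation on `|s| < 20/11` (telescoping on the
  recursion), and `continuousOn_sphDer_one` — `λ ↦ S'_λ(s = 1)` is continuous on `[-1/2, 1/2]`
  (the shooting function used in `SpheroidalEigenfunction.lean`).

Mathlib has no spheroidal functions (`lean search spheroidal`: nothing); the Legendre case
`c = 0` is not used.

## References

* Y. Shlapentokh-Rothman, *Exponentially growing finite energy solutions for the Klein–Gordon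
  equation on sub-extremal Kerr spacetimes*, Comm. Math. Phys. 329 (2014) 859–891, §2 (the
  angular ODE). Key `ShlapentokhRothman2014KleinGordon`.
-/

noncomputable section

open Set Filter Metric
open scoped Topology

namespace Literature.Analysis.SpecialFunctions

/-! ### Power series with geometrically bounded coefficients: term-wise calculus -/

section PowerSeries

variable {b : ℕ → ℝ} {p : ℝ}

/-- The power series `Σ bₙ sⁿ` (Mathlib's junk value `0` where it diverges). [folklore] -/
def psFun (b : ℕ → ℝ) (s : ℝ) : ℝ := ∑' n, b n * s ^ n

/-- The term-wise derivative `Σ n bₙ sⁿ⁻¹`. [folklore] -/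
def psDer (b : ℕ → ℝ) (s : ℝ) : ℝ := ∑' n : ℕ, b n * ((n : ℝ) * s ^ (n - 1))

/-- The term-wise second derivative `Σ n(n-1) bₙ sⁿ⁻²`. [folklore] -/
def psDer₂ (b : ℕ → ℝ) (s : ℝ) : ℝ :=
  ∑' n : ℕ, b n * ((n : ℝ) * (((n - 1 : ℕ) : ℝ) * s ^ (n - 1 - 1)))

/-- `n ↦ n qⁿ⁻¹` is summable for `0 ≤ q < 1`. [folklore] -/
theorem summable_nat_mul_pow_pred {q : ℝ} (hq0 : 0 ≤ q) (hq : q < 1) :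
    Summable fun n : ℕ ↦ (n : ℝ) * q ^ (n - 1) := by
  have hqn : ‖q‖ < 1 := by rwa [Real.norm_eq_abs, abs_of_nonneg hq0]
  rw [← summable_nat_add_iff 1]
  have h1 := summable_pow_mul_geometric_of_norm_lt_one 1 hqn
  have h0 := summable_geometric_of_lt_one hq0 hq
  simp only [pow_one] at h1
  refine (h1.add h0).congr fun n ↦ ?_
  simp only [Nat.add_sub_cancel]
  push_cast
  ring

/-- `n ↦ n(n-1) qⁿ⁻²` is summable for `0 ≤ q < 1`. [folklore] -/
theorem summable_nat_mul_pred_mul_pow {q : ℝ} (hq0 : 0 ≤ q) (hq : q < 1) :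
    Summable fun n : ℕ ↦ (n : ℝ) * (((n - 1 : ℕ) : ℝ) * q ^ (n - 1 - 1)) := by
  have hqn : ‖q‖ < 1 := by rwa [Real.norm_eq_abs, abs_of_nonneg hq0]
  rw [← summable_nat_add_iff 2]
  have h2 := summable_pow_mul_geometric_of_norm_lt_one 2 hqn
  have h1 := summable_pow_mul_geometric_of_norm_lt_one 1 hqn
  have h0 := summable_geometric_of_lt_one hq0 hq
  simp only [pow_one] at h1
  refine ((h2.add (h1.mul_left 3)).add (h0.mul_left 2)).congr fun n ↦ ?_
  simp only [show n + 2 - 1 = n + 1 from rfl, Nat.add_sub_cancel]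
  push_cast
  ring

/-- Under `|bₙ| ≤ pⁿ` the series `Σ bₙ sⁿ` converges absolutely for `p|s| < 1`. [folklore] -/
theorem summable_psFun_term (hp : 0 < p) (hb : ∀ n, |b n| ≤ p ^ n) {s : ℝ} (hs : |s| < p⁻¹) :
    Summable fun n ↦ b n * s ^ n := by
  have hq1 : p * |s| < 1 := by rwa [← lt_div_iff₀' hp, one_div]
  refine Summable.of_norm_bounded (g := fun n ↦ (p * |s|) ^ n)
    (summable_geometric_of_lt_one (by positivity) hq1) fun n ↦ ?_
  rw [Real.norm_eq_abs, abs_mul, abs_pow, mul_pow]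
  exact mul_le_mul_of_nonneg_right (hb n) (pow_nonneg (abs_nonneg s) n)

/-- The weights of the first derivative: `pⁿ n ρⁿ⁻¹ = p · n (pρ)ⁿ⁻¹`. [folklore] -/
theorem pow_mul_nat_mul_pow_pred (p ρ : ℝ) (n : ℕ) :
    p ^ n * ((n : ℝ) * ρ ^ (n - 1)) = p * ((n : ℝ) * (p * ρ) ^ (n - 1)) := by
  rcases n with _ | m
  · simp
  · simp only [Nat.add_sub_cancel, pow_succ, mul_pow]
    push_cast
    ring

/-- The weights of the second derivative: `pⁿ n(n-1) ρⁿ⁻² = p² · n(n-1) (pρ)ⁿ⁻²`. [folklore] -/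
theorem pow_mul_nat_mul_pred_mul_pow (p ρ : ℝ) (n : ℕ) :
    p ^ n * ((n : ℝ) * (((n - 1 : ℕ) : ℝ) * ρ ^ (n - 1 - 1))) =
      p ^ 2 * ((n : ℝ) * (((n - 1 : ℕ) : ℝ) * (p * ρ) ^ (n - 1 - 1))) := by
  rcases n with _ | _ | m
  · simp
  · simp
  · simp only [Nat.add_sub_cancel, show m + 2 - 1 = m + 1 from rfl, pow_succ, mul_pow]
    push_cast
    ring

/-- **Term-wise differentiation of `Σ bₙ sⁿ`** inside the radius: for `|bₙ| ≤ pⁿ` and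
`|s| < p⁻¹`, `HasDerivAt (psFun b) (psDer b s) s`. [folklore] -/
theorem hasDerivAt_psFun (hp : 0 < p) (hb : ∀ n, |b n| ≤ p ^ n) {s : ℝ} (hs : |s| < p⁻¹) :
    HasDerivAt (psFun b) (psDer b s) s := by
  obtain ⟨ρ, hsρ, hρ⟩ := exists_between hs
  have hρpos : 0 < ρ := (abs_nonneg s).trans_lt hsρ
  have hq0 : 0 ≤ p * ρ := by positivity
  have hq1 : p * ρ < 1 := by rwa [← lt_div_iff₀' hp, one_div]
  unfold psFun psDer
  refine hasDerivAt_tsum_of_isPreconnected (u := fun n : ℕ ↦ p ^ n * ((n : ℝ) * ρ ^ (n - 1)))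
    (t := Ioo (-ρ) ρ) (y₀ := 0) ?_ isOpen_Ioo (convex_Ioo _ _).isPreconnected
    (fun n y _ ↦ (hasDerivAt_pow n y).const_mul _) (fun n y hy ↦ ?_) ⟨by linarith, hρpos⟩ ?_
    (abs_lt.1 hsρ)
  · simp_rw [pow_mul_nat_mul_pow_pred]
    exact (summable_nat_mul_pow_pred hq0 hq1).mul_left p
  · have hy' : |y| ≤ ρ := (abs_lt.2 hy).le
    rw [Real.norm_eq_abs, abs_mul, abs_mul, abs_pow, Nat.abs_cast]
    gcongr
    exact hb n
  · simpa using summable_psFun_term hp hb (s := 0) (by simp [hp])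

/-- **Term-wise differentiation of `Σ n bₙ sⁿ⁻¹`** inside the radius:
`HasDerivAt (psDer b) (psDer₂ b s) s` for `|s| < p⁻¹`. [folklore] -/
theorem hasDerivAt_psDer (hp : 0 < p) (hb : ∀ n, |b n| ≤ p ^ n) {s : ℝ} (hs : |s| < p⁻¹) :
    HasDerivAt (psDer b) (psDer₂ b s) s := by
  obtain ⟨ρ, hsρ, hρ⟩ := exists_between hs
  have hρpos : 0 < ρ := (abs_nonneg s).trans_lt hsρ
  have hq0 : 0 ≤ p * ρ := by positivity
  have hq1 : p * ρ < 1 := by rwa [← lt_div_iff₀' hp, one_div]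
  unfold psDer psDer₂
  refine hasDerivAt_tsum_of_isPreconnected
    (u := fun n : ℕ ↦ p ^ n * ((n : ℝ) * (((n - 1 : ℕ) : ℝ) * ρ ^ (n - 1 - 1))))
    (t := Ioo (-ρ) ρ) (y₀ := 0) ?_ isOpen_Ioo (convex_Ioo _ _).isPreconnected
    (fun n y _ ↦ ((hasDerivAt_pow (n - 1) y).const_mul _).const_mul _)
    (fun n y hy ↦ ?_) ⟨by linarith, hρpos⟩ ?_ (abs_lt.1 hsρ)
  · simp_rw [pow_mul_nat_mul_pred_mul_pow]
    exact (summable_nat_mul_pred_mul_pow hq0 hq1).mul_left (p ^ 2)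
  · have hy' : |y| ≤ ρ := (abs_lt.2 hy).le
    rw [Real.norm_eq_abs, abs_mul, abs_mul, abs_mul, abs_pow, Nat.abs_cast, Nat.abs_cast]
    gcongr
    exact hb n
  · refine Summable.of_norm_bounded (g := fun n : ℕ ↦ p ^ n * ((n : ℝ) * (0 : ℝ) ^ (n - 1)))
      ?_ fun n ↦ ?_
    · simp_rw [pow_mul_nat_mul_pow_pred, mul_zero]
      exact (summable_nat_mul_pow_pred le_rfl zero_lt_one).mul_left p
    · rw [Real.norm_eq_abs, abs_mul, abs_mul, Nat.abs_cast, abs_pow, abs_zero]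
      gcongr
      exact hb n

/-- `HasSum (bₙ sⁿ) (psFun b s)` inside the radius. [folklore] -/
theorem hasSum_psFun (hp : 0 < p) (hb : ∀ n, |b n| ≤ p ^ n) {s : ℝ} (hs : |s| < p⁻¹) :
    HasSum (fun n ↦ b n * s ^ n) (psFun b s) :=
  (summable_psFun_term hp hb hs).hasSum

/-- `HasSum (n bₙ sⁿ⁻¹) (psDer b s)` inside the radius. [folklore] -/
theorem hasSum_psDer (hp : 0 < p) (hb : ∀ n, |b n| ≤ p ^ n) {s : ℝ} (hs : |s| < p⁻¹) :
    HasSum (fun n : ℕ ↦ b n * ((n : ℝ) * s ^ (n - 1))) (psDer b s) := by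
  have hq1 : p * |s| < 1 := by rwa [← lt_div_iff₀' hp, one_div]
  have hsum : Summable fun n : ℕ ↦ b n * ((n : ℝ) * s ^ (n - 1)) := by
    refine Summable.of_norm_bounded (g := fun n : ℕ ↦ p ^ n * ((n : ℝ) * |s| ^ (n - 1))) ?_
      fun n ↦ ?_
    · simp_rw [pow_mul_nat_mul_pow_pred]
      exact (summable_nat_mul_pow_pred (by positivity) hq1).mul_left p
    · rw [Real.norm_eq_abs, abs_mul, abs_mul, abs_pow, Nat.abs_cast]
      gcongr
      exact hb n
  exact hsum.hasSum

/-- `HasSum (n(n-1) bₙ sⁿ⁻²) (psDer₂ b s)` inside the radius. [folklore] -/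
theorem hasSum_psDer₂ (hp : 0 < p) (hb : ∀ n, |b n| ≤ p ^ n) {s : ℝ} (hs : |s| < p⁻¹) :
    HasSum (fun n : ℕ ↦ b n * ((n : ℝ) * (((n - 1 : ℕ) : ℝ) * s ^ (n - 1 - 1)))) (psDer₂ b s) := by
  have hq1 : p * |s| < 1 := by rwa [← lt_div_iff₀' hp, one_div]
  have hsum : Summable fun n : ℕ ↦ b n * ((n : ℝ) * (((n - 1 : ℕ) : ℝ) * s ^ (n - 1 - 1))) := by
    refine Summable.of_norm_bounded
      (g := fun n : ℕ ↦ p ^ n * ((n : ℝ) * (((n - 1 : ℕ) : ℝ) * |s| ^ (n - 1 - 1)))) ?_ fun n ↦ ?_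
    · simp_rw [pow_mul_nat_mul_pred_mul_pow]
      exact (summable_nat_mul_pred_mul_pow (by positivity) hq1).mul_left (p ^ 2)
    · rw [Real.norm_eq_abs, abs_mul, abs_mul, abs_mul, abs_pow, Nat.abs_cast, Nat.abs_cast]
      gcongr
      exact hb n
  exact hsum.hasSum

/-- The radius of convergence of `Σ bₙ sⁿ` is at least `p⁻¹` when `|bₙ| ≤ pⁿ`. [folklore] -/
theorem inv_le_radius_ofScalars (hp : 0 < p) (hb : ∀ n, |b n| ≤ p ^ n) :
    ENNReal.ofReal p⁻¹ ≤ (FormalMultilinearSeries.ofScalars ℝ b).radius := by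
  refine ENNReal.le_of_forall_nnreal_lt fun r hr ↦ ?_
  have hr' : (r : ℝ) < p⁻¹ := by
    have := (ENNReal.ofReal_lt_ofReal_iff_of_nonneg r.2).1 (by simpa using hr)
    simpa using this
  have hpr : p * r < 1 := by rwa [← lt_div_iff₀' hp, one_div]
  refine FormalMultilinearSeries.le_radius_of_bound _ (C := 1) fun n ↦ ?_
  rw [FormalMultilinearSeries.ofScalars_norm, Real.norm_eq_abs]
  calc |b n| * (r : ℝ) ^ n ≤ p ^ n * (r : ℝ) ^ n := by gcongr; exact hb n
    _ = (p * r) ^ n := by rw [mul_pow]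
    _ ≤ 1 := pow_le_one₀ (by positivity) hpr.le

/-- **The sum of the series is analytic, hence `C^∞`, inside the radius**: for `|bₙ| ≤ pⁿ` and
`|s| < p⁻¹`, `psFun b` is `Cⁿ` at `s` for every `n ≤ ω`. [folklore] -/
theorem contDiffAt_psFun (hp : 0 < p) (hb : ∀ n, |b n| ≤ p ^ n) {s : ℝ} (hs : |s| < p⁻¹)
    {n : WithTop ℕ∞} : ContDiffAt ℝ n (psFun b) s := by
  set q := FormalMultilinearSeries.ofScalars ℝ b with hq
  have hrad : ENNReal.ofReal p⁻¹ ≤ q.radius := inv_le_radius_ofScalars hp hb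
  have hpos : 0 < q.radius := lt_of_lt_of_le (by simpa using hp) hrad
  have hps : HasFPowerSeriesOnBall (FormalMultilinearSeries.ofScalarsSum (E := ℝ) b) q 0 q.radius :=
    q.hasFPowerSeriesOnBall hpos
  have hfun : psFun b = FormalMultilinearSeries.ofScalarsSum (E := ℝ) b := by
    funext x
    rw [FormalMultilinearSeries.ofScalars_sum_eq]
    simp [psFun, smul_eq_mul]
  have hmem : s ∈ Metric.eball (0 : ℝ) q.radius := by
    refine Metric.eball_subset_eball hrad ?_
    rw [Metric.eball_ofReal, mem_ball_zero_iff, Real.norm_eq_abs]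
    exact hs
  rw [hfun]
  exact (hps.analyticAt_of_mem hmem).contDiffAt

end PowerSeries

/-! ### The Frobenius coefficients of the axisymmetric spheroidal equation -/

/-- Three consecutive Frobenius coefficients `(bₙ, bₙ₊₁, bₙ₊₂)` of the axisymmetric spheroidal
equation at the pole (`b₀ = 1`, `b₁ = (c - λ)/2`, `8 b₂ = (2 - λ + c) b₁ - 2c`, and
`2(n+3)² b_{n+3} = ((n+2)(n+3) - λ + c) b_{n+2} - 2c b_{n+1} + c bₙ`). SR, CMP 329 (2014), §2
(angular ODE, `m = 0`); DLMF §30.2. [cite: ShlapentokhRothman2014KleinGordon, §2] -/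
def sphTriple (lam c : ℝ) : ℕ → ℝ × ℝ × ℝ
  | 0 => (1, (c - lam) / 2, ((2 - lam + c) * ((c - lam) / 2) - 2 * c) / 8)
  | n + 1 =>
    ((sphTriple lam c n).2.1, (sphTriple lam c n).2.2,
      ((((n : ℝ) + 2) * ((n : ℝ) + 3) - lam + c) * (sphTriple lam c n).2.2 -
          2 * c * (sphTriple lam c n).2.1 + c * (sphTriple lam c n).1) / (2 * ((n : ℝ) + 3) ^ 2))

/-- **The Frobenius coefficients `bₙ(λ, c)`** of the solution `Σ bₙ (1 - χ)ⁿ`, analytic at the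
pole `χ = 1` and equal to `1` there, of `((1 - χ²) S')' + (λ - c χ²) S = 0`. SR, CMP 329 (2014),
§2 (angular ODE, `m = 0`); DLMF §30.2. [cite: ShlapentokhRothman2014KleinGordon, §2] -/
def sphCoeff (lam c : ℝ) (n : ℕ) : ℝ := (sphTriple lam c n).1

/-- `b₀ = 1`. [folklore] -/
@[simp] theorem sphCoeff_zero (lam c : ℝ) : sphCoeff lam c 0 = 1 := rfl

/-- `b₁ = (c - λ)/2` (the recursion at `n = 0`: `2 b₁ = (0 - λ + c) b₀`). [folklore] -/
theorem sphCoeff_one (lam c : ℝ) : sphCoeff lam c 1 = (c - lam) / 2 := rfl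

/-- `b₂ = ((2 - λ + c) b₁ - 2c b₀)/8` (the recursion at `n = 1`). [folklore] -/
theorem sphCoeff_two (lam c : ℝ) :
    sphCoeff lam c 2 = ((2 - lam + c) * ((c - lam) / 2) - 2 * c) / 8 := rfl

/-- **The recursion** `2(n+3)² b_{n+3} = ((n+2)(n+3) - λ + c) b_{n+2} - 2c b_{n+1} + c bₙ`.
[cite: ShlapentokhRothman2014KleinGordon, §2] -/
theorem sphCoeff_succ_succ_succ (lam c : ℝ) (n : ℕ) :
    sphCoeff lam c (n + 3) =
      ((((n : ℝ) + 2) * ((n : ℝ) + 3) - lam + c) * sphCoeff lam c (n + 2) -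
          2 * c * sphCoeff lam c (n + 1) + c * sphCoeff lam c n) / (2 * ((n : ℝ) + 3) ^ 2) := rfl

/-- The coefficients depend continuously (indeed polynomially) on `λ`. [folklore] -/
theorem continuous_sphTriple (c : ℝ) (n : ℕ) : Continuous fun lam : ℝ ↦ sphTriple lam c n := by
  induction n with
  | zero =>
    simp only [sphTriple]
    fun_prop
  | succ k ih =>
    simp only [sphTriple]
    have h1 : Continuous fun lam : ℝ ↦ (sphTriple lam c k).1 := continuous_fst.comp ih
    have h2 : Continuous fun lam : ℝ ↦ (sphTriple lam c k).2.1 :=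
      continuous_fst.comp (continuous_snd.comp ih)
    have h3 : Continuous fun lam : ℝ ↦ (sphTriple lam c k).2.2 :=
      continuous_snd.comp (continuous_snd.comp ih)
    fun_prop

/-- `λ ↦ bₙ(λ, c)` is continuous. [folklore] -/
theorem continuous_sphCoeff (c : ℝ) (n : ℕ) : Continuous fun lam : ℝ ↦ sphCoeff lam c n :=
  continuous_fst.comp (continuous_sphTriple c n)

/-- The inductive step of the coefficient bound: if `|b_k| ≤ (11/20)ᵏ` for `k = n, n+1, n+2`
then also for `k = n+3` (`|λ| ≤ 1/2`, `0 ≤ c ≤ 1/100`; the ratio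
`((n+2)(n+3) + 1/2 + c) p² + 2cp + c ≤ 2(n+3)² p³` holds for `p = 11/20`). [folklore] -/
theorem abs_sphCoeff_succ_succ_succ_le {lam c : ℝ} (hlam : |lam| ≤ 1 / 2) (hc0 : 0 ≤ c)
    (hc1 : c ≤ 1 / 100) {n : ℕ} (h0 : |sphCoeff lam c n| ≤ (11 / 20) ^ n)
    (h1 : |sphCoeff lam c (n + 1)| ≤ (11 / 20) ^ (n + 1))
    (h2 : |sphCoeff lam c (n + 2)| ≤ (11 / 20) ^ (n + 2)) :
    |sphCoeff lam c (n + 3)| ≤ (11 / 20) ^ (n + 3) := by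
  rw [sphCoeff_succ_succ_succ]
  set A : ℝ := ((n : ℝ) + 2) * ((n : ℝ) + 3) with hA_def
  have hn : (0 : ℝ) ≤ n := n.cast_nonneg
  have hA : 0 ≤ A := by positivity
  have hden : 0 < 2 * ((n : ℝ) + 3) ^ 2 := by positivity
  have hcoef : |A - lam + c| ≤ A + 1 / 2 + c := by
    rw [abs_le] at hlam ⊢
    constructor <;> linarith [hlam.1, hlam.2]
  rw [abs_div, abs_of_pos hden, div_le_iff₀ hden]
  have hp : (0 : ℝ) < (11 / 20) ^ n := by positivity
  have key : (A + 1 / 2 + c) * (11 / 20) ^ 2 + 2 * c * (11 / 20) + c ≤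
      (11 / 20) ^ 3 * (2 * ((n : ℝ) + 3) ^ 2) := by
    rw [hA_def]
    nlinarith [hn, hc0, hc1, sq_nonneg (n : ℝ)]
  calc |(A - lam + c) * sphCoeff lam c (n + 2) - 2 * c * sphCoeff lam c (n + 1) +
          c * sphCoeff lam c n|
      ≤ |(A - lam + c) * sphCoeff lam c (n + 2) - 2 * c * sphCoeff lam c (n + 1)| +
          |c * sphCoeff lam c n| := abs_add_le _ _
    _ ≤ |(A - lam + c) * sphCoeff lam c (n + 2)| + |2 * c * sphCoeff lam c (n + 1)| +
          |c * sphCoeff lam c n| := by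
        gcongr
        exact abs_sub _ _
    _ = |A - lam + c| * |sphCoeff lam c (n + 2)| + 2 * c * |sphCoeff lam c (n + 1)| +
          c * |sphCoeff lam c n| := by
        have e2 : |(A - lam + c) * sphCoeff lam c (n + 2)| =
            |A - lam + c| * |sphCoeff lam c (n + 2)| := abs_mul _ _
        have e1 : |2 * c * sphCoeff lam c (n + 1)| = 2 * c * |sphCoeff lam c (n + 1)| := by
          rw [abs_mul, abs_of_nonneg (by positivity : (0 : ℝ) ≤ 2 * c)]
        have e0 : |c * sphCoeff lam c n| = c * |sphCoeff lam c n| := by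
          rw [abs_mul, abs_of_nonneg hc0]
        rw [e2, e1, e0]
    _ ≤ (A + 1 / 2 + c) * (11 / 20) ^ (n + 2) + 2 * c * (11 / 20) ^ (n + 1) +
          c * (11 / 20) ^ n := by
        gcongr
    _ = (11 / 20) ^ n * ((A + 1 / 2 + c) * (11 / 20) ^ 2 + 2 * c * (11 / 20) + c) := by ring
    _ ≤ (11 / 20) ^ n * ((11 / 20) ^ 3 * (2 * ((n : ℝ) + 3) ^ 2)) :=
        mul_le_mul_of_nonneg_left key hp.le
    _ = (11 / 20) ^ (n + 3) * (2 * ((n : ℝ) + 3) ^ 2) := by ring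

/-- **Geometric bound on the Frobenius coefficients**: `|bₙ(λ, c)| ≤ (11/20)ⁿ` for `|λ| ≤ 1/2`
and `0 ≤ c ≤ 1/100`; in particular the series `Σ bₙ sⁿ` has radius of convergence `≥ 20/11`.
[folklore] -/
theorem abs_sphCoeff_le {lam c : ℝ} (hlam : |lam| ≤ 1 / 2) (hc0 : 0 ≤ c) (hc1 : c ≤ 1 / 100)
    (n : ℕ) : |sphCoeff lam c n| ≤ (11 / 20) ^ n := by
  suffices H : ∀ n, |sphCoeff lam c n| ≤ (11 / 20) ^ n ∧
      |sphCoeff lam c (n + 1)| ≤ (11 / 20) ^ (n + 1) ∧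
      |sphCoeff lam c (n + 2)| ≤ (11 / 20) ^ (n + 2) from (H n).1
  intro n
  induction n with
  | zero =>
    have hl := abs_le.1 hlam
    refine ⟨by simp, ?_, ?_⟩
    · rw [sphCoeff_one, abs_le]
      constructor <;> nlinarith [hl.1, hl.2]
    · rw [sphCoeff_two, abs_le]
      constructor <;> nlinarith [hl.1, hl.2]
  | succ k ih =>
    exact ⟨ih.2.1, ih.2.2, abs_sphCoeff_succ_succ_succ_le hlam hc0 hc1 ih.1 ih.2.1 ih.2.2⟩

/-- `20/11 = (11/20)⁻¹`, the guaranteed radius. [folklore] -/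
theorem sph_radius_eq : ((11 : ℝ) / 20)⁻¹ = 20 / 11 := by norm_num

/-! ### The Frobenius solution and the spheroidal equation -/

/-- **The Frobenius solution** `S_λ(s) = Σ bₙ(λ, c) sⁿ` of the axisymmetric spheroidal equation in
the pole variable `s = 1 - χ` (analytic on `|s| < 20/11` for `|λ| ≤ 1/2`, `0 ≤ c ≤ 1/100`,
`S_λ(0) = 1`). SR, CMP 329 (2014), §2; DLMF §30.2. [cite: ShlapentokhRothman2014KleinGordon, §2] -/
def sphFun (lam c : ℝ) : ℝ → ℝ := psFun (sphCoeff lam c)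

/-- The term-wise derivative `S_λ'(s) = Σ n bₙ sⁿ⁻¹`. [folklore] -/
def sphDer (lam c : ℝ) : ℝ → ℝ := psDer (sphCoeff lam c)

/-- The term-wise second derivative `S_λ''(s) = Σ n(n-1) bₙ sⁿ⁻²`. [folklore] -/
def sphDer₂ (lam c : ℝ) : ℝ → ℝ := psDer₂ (sphCoeff lam c)

/-- `S_λ(0) = 1`. [folklore] -/
theorem sphFun_zero (lam c : ℝ) : sphFun lam c 0 = 1 := by
  rw [sphFun, psFun, tsum_eq_single 0 fun n hn ↦ by simp [hn]]
  simp

section ODE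

variable {lam c : ℝ} (hlam : |lam| ≤ 1 / 2) (hc0 : 0 ≤ c) (hc1 : c ≤ 1 / 100)
include hlam hc0 hc1

/-- `S_λ' = sphDer` on `|s| < 20/11`. [folklore] -/
theorem hasDerivAt_sphFun {s : ℝ} (hs : |s| < 20 / 11) :
    HasDerivAt (sphFun lam c) (sphDer lam c s) s :=
  hasDerivAt_psFun (by norm_num) (abs_sphCoeff_le hlam hc0 hc1) (by rwa [sph_radius_eq])

/-- `(sphDer)' = sphDer₂` on `|s| < 20/11`. [folklore] -/
theorem hasDerivAt_sphDer {s : ℝ} (hs : |s| < 20 / 11) :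
    HasDerivAt (sphDer lam c) (sphDer₂ lam c s) s :=
  hasDerivAt_psDer (by norm_num) (abs_sphCoeff_le hlam hc0 hc1) (by rwa [sph_radius_eq])

/-- `S_λ` is `Cⁿ` (every `n ≤ ω`) at each `|s| < 20/11`. [folklore] -/
theorem contDiffAt_sphFun {s : ℝ} (hs : |s| < 20 / 11) {n : WithTop ℕ∞} :
    ContDiffAt ℝ n (sphFun lam c) s :=
  contDiffAt_psFun (by norm_num) (abs_sphCoeff_le hlam hc0 hc1) (by rwa [sph_radius_eq])

/-- **The Frobenius series solves the spheroidal equation in the pole variable**: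
`s(2 - s) S'' + (2 - 2s) S' + (λ - c(1 - s)²) S = 0` on `|s| < 20/11`, i.e.
`((1 - χ²) S_χ)_χ + (λ - cχ²) S = 0` with `s = 1 - χ` (term-wise: the coefficient of `sᵐ` is
`2(m+1)² b_{m+1} - (m(m+1) - λ + c) bₘ + 2c b_{m-1} - c b_{m-2} = 0`, the recursion; summed by
telescoping). SR, CMP 329 (2014), §2 (angular ODE, `m = 0`). [cite: ShlapentokhRothman2014KleinGordon, §2] -/
theorem sphFun_ode {s : ℝ} (hs : |s| < 20 / 11) :
    s * (2 - s) * sphDer₂ lam c s + (2 - 2 * s) * sphDer lam c s +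
      (lam - c * (1 - s) ^ 2) * sphFun lam c s = 0 := by
  have hp : (0 : ℝ) < 11 / 20 := by norm_num
  have hb := abs_sphCoeff_le hlam hc0 hc1
  have hs' : |s| < ((11 : ℝ) / 20)⁻¹ := by rwa [sph_radius_eq]
  set b : ℕ → ℝ := sphCoeff lam c with hbdef
  have S0 : HasSum (fun n ↦ b n * s ^ n) (sphFun lam c s) := hasSum_psFun hp hb hs'
  have S1 : HasSum (fun n : ℕ ↦ b n * ((n : ℝ) * s ^ (n - 1))) (sphDer lam c s) :=
    hasSum_psDer hp hb hs'
  have S2 : HasSum (fun n : ℕ ↦ b n * ((n : ℝ) * (((n - 1 : ℕ) : ℝ) * s ^ (n - 1 - 1))))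
      (sphDer₂ lam c s) := hasSum_psDer₂ hp hb hs'
  -- the four pieces `U n = 2n² bₙ sⁿ⁻¹`, `V n = (n(n+1) - λ + c) bₙ sⁿ`, `W n = 2c bₙ sⁿ⁺¹`,
  -- `X n = c bₙ sⁿ⁺²`; the summand of the left-hand side is `U - V + W - X`
  set U : ℕ → ℝ := fun n ↦ 2 * (n : ℝ) ^ 2 * b n * s ^ (n - 1) with hU
  set V : ℕ → ℝ := fun n ↦ ((n : ℝ) * ((n : ℝ) + 1) - lam + c) * b n * s ^ n with hV
  set W : ℕ → ℝ := fun n ↦ 2 * c * b n * s ^ (n + 1) with hW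
  set X : ℕ → ℝ := fun n ↦ c * b n * s ^ (n + 2) with hX
  have hT : HasSum (fun n ↦ U n - V n + W n - X n)
      (s * (2 - s) * sphDer₂ lam c s + (2 - 2 * s) * sphDer lam c s +
        (lam - c * (1 - s) ^ 2) * sphFun lam c s) := by
    have h := ((S2.mul_left (s * (2 - s))).add (S1.mul_left (2 - 2 * s))).add
      (S0.mul_left (lam - c * (1 - s) ^ 2))
    refine h.congr_fun fun n ↦ ?_
    simp only [hU, hV, hW, hX]
    rcases n with _ | _ | m
    · simp
      ring
    · simp
      ring
    · simp only [Nat.add_sub_cancel, show m + 2 - 1 = m + 1 from rfl]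
      push_cast
      ring
  -- the sums of the pieces, shifted so that the recursion applies termwise
  have hVs : Summable V := by
    have h := ((S2.mul_left (s ^ 2)).add (S1.mul_left (2 * s))).add (S0.mul_left (c - lam))
    refine h.summable.congr fun n ↦ ?_
    simp only [hV]
    rcases n with _ | _ | m
    · simp only [Nat.cast_zero, pow_zero]
      ring
    · simp
      ring
    · simp only [Nat.add_sub_cancel, show m + 2 - 1 = m + 1 from rfl]
      push_cast
      ring
  have hWs : Summable W := by
    refine ((S0.mul_left (2 * c * s)).summable).congr fun n ↦ ?_
    simp only [hW, pow_succ]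
    ring
  have hXs : Summable X := by
    refine ((S0.mul_left (c * s ^ 2)).summable).congr fun n ↦ ?_
    simp only [hX, pow_succ]
    ring
  -- `U (n+3) = V (n+2) - W (n+1) + X n`, `U 0 = 0`, `U 1 = V 0`, `U 2 = V 1 - W 0`
  have hU0 : U 0 = 0 := by simp [hU]
  have hU1 : U 1 = V 0 := by
    simp only [hU, hV, hbdef, sphCoeff_one, sphCoeff_zero]
    simp
    ring
  have hU2 : U 2 = V 1 - W 0 := by
    simp only [hU, hV, hW, hbdef, sphCoeff_two, sphCoeff_one, sphCoeff_zero]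
    simp
    ring
  have hU3 : ∀ n, U (n + 3) = V (n + 2) - W (n + 1) + X n := by
    intro n
    simp only [hU, hV, hW, hX, hbdef, sphCoeff_succ_succ_succ, show n + 3 - 1 = n + 2 from rfl,
      show n + 1 + 1 = n + 2 from rfl]
    have h3 : (2 * ((n : ℝ) + 3) ^ 2) ≠ 0 := by positivity
    push_cast
    field_simp
    ring
  have hUs : Summable U := by
    rw [← summable_nat_add_iff 3]
    simp_rw [hU3]
    exact (((summable_nat_add_iff 2).2 hVs).sub ((summable_nat_add_iff 1).2 hWs)).add hXs
  -- `Σ U = Σ V - Σ W + Σ X`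
  have hsumU : ∑' n, U n = ∑' n, V n - ∑' n, W n + ∑' n, X n := by
    have eU := (hUs.sum_add_tsum_nat_add 3).symm
    have eV := (hVs.sum_add_tsum_nat_add 2).symm
    have eW := (hWs.sum_add_tsum_nat_add 1).symm
    rw [Finset.sum_range_succ, Finset.sum_range_succ, Finset.sum_range_succ,
      Finset.sum_range_zero] at eU
    rw [Finset.sum_range_succ, Finset.sum_range_succ, Finset.sum_range_zero] at eV
    rw [Finset.sum_range_succ, Finset.sum_range_zero] at eW
    have e3 : ∑' n, U (n + 3) = ∑' n, V (n + 2) - ∑' n, W (n + 1) + ∑' n, X n := by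
      simp_rw [hU3]
      rw [(((summable_nat_add_iff 2).2 hVs).sub ((summable_nat_add_iff 1).2 hWs)).tsum_add hXs,
        ((summable_nat_add_iff 2).2 hVs).tsum_sub ((summable_nat_add_iff 1).2 hWs)]
    rw [eU, eV, eW, e3, hU0, hU1, hU2]
    ring
  have hzero : ∑' n, (U n - V n + W n - X n) = 0 := by
    rw [((hUs.sub hVs).add hWs).tsum_sub hXs, (hUs.sub hVs).tsum_add hWs, hUs.tsum_sub hVs, hsumU]
    ring
  rw [← hT.tsum_eq, hzero]

omit hlam in
/-- **The shooting function is continuous**: `λ ↦ S_λ'(1) = Σ n bₙ(λ, c)` is continuous on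
`[-1/2, 1/2]` (uniform majorant `n (11/20)ⁿ⁻¹`). [folklore] -/
theorem continuousOn_sphDer_one :
    ContinuousOn (fun lam : ℝ ↦ sphDer lam c 1) (Icc (-1 / 2) (1 / 2)) := by
  have hfun : (fun lam : ℝ ↦ sphDer lam c 1) =
      fun lam ↦ ∑' n : ℕ, sphCoeff lam c n * ((n : ℝ) * (1 : ℝ) ^ (n - 1)) := rfl
  rw [hfun]
  refine continuousOn_tsum (u := fun n : ℕ ↦ (11 / 20 : ℝ) ^ n * ((n : ℝ) * (1 : ℝ) ^ (n - 1)))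
    (fun n ↦ ((continuous_sphCoeff c n).mul continuous_const).continuousOn) ?_ fun n lam hl ↦ ?_
  · simp_rw [pow_mul_nat_mul_pow_pred]
    exact (summable_nat_mul_pow_pred (by norm_num) (by norm_num)).mul_left _
  · have hl' : |lam| ≤ 1 / 2 := by
      rw [abs_le]; constructor <;> linarith [hl.1, hl.2]
    rw [Real.norm_eq_abs, abs_mul, abs_mul, Nat.abs_cast, one_pow, abs_one]
    gcongr
    exact abs_sphCoeff_le hl' hc0 hc1 n

end ODE

end Literature.Analysis.SpecialFunctions
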